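import Summits.BirchSwinnertonDyer.BirchSwinnertonDyer.Theorems.SchneiderFreeAdditiveX3UpperGordCellThreeAnomalousOfPartnerClass
import Summits.BirchSwinnertonDyer.BirchSwinnertonDyer.Theorems.SchneiderFreeAdditiveX3UpperGordCellThreeAnomalousOfTree
import HarnessLib

/-!
# Route `SchneiderFreeAdditiveX3Upper` (K1 wing) / `SchneiderFreeAdditiveX3` (K1 door), the (G-ord, `e = 2`) cell AT `p = 3`: the field co-socket and the UPPER half
# of BSD₃ PER PAIR WITHOUT the named facts [RH] / [PWL-θ] of Keller–Yin 2402.12781 — their role (the `μ`-input on the 1 725 anomalous pairs) taken by Bleher et al.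
# 2020 Thm. 3.3.1, de Shalit II.6.4, Hida Thm I on the tree's Milne ADT I 4.10 (a) (FILE 7 of generation 41's [RH] re-key; twins of generation 32's PartnerClass file)

Cell `bsd-schneider-ideate`, seat `bsd-schneider-door-c5` (prover, generation 41; assembly layer; `--supports` 19177, helper — the upper half enters the door's per-pair
BOTH-halves records).  PARTITION: board row B6 ∩ X3 ∩ sst-twist, `r = 1`, (G-ord, `e = 2`) half at `p = 3` (2 411 census pairs: 686 NAT + 1 725 anomalous) of
`Rank1Residual.partition` — COMPOSITION theorems; types-the-object-of nothing; closes none of B6's cells (BSD NOT advanced).  bears_on: K1-door (19177 r3; per-pair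
statements of `BSDp`), K1-wing (20365).
* §1 `additiveIMCUpperBDPInputManinAtField_three_of_tree_of_partnerClass` — the wing's field co-socket for an anomalous twist with a Keller–Yin-normalised member of
  the PARTNER CLASS (twin of generation 32's `…_of_RH_of_PWL_of_partnerClass`, calling FILE 6's `…_of_tree_at_partner_of_isIsogenous`).
* §2 `missingUpperBoundAt_gordTwo_three_of_printedFacts_of_twistUnitAt_of_partnerClass_of_tree`, `missingUpperBoundAt_gordTwo_three_of_printedFacts_of_twistUnitAt_of_tree`
  — the UPPER half per pair on the WHOLE (G-ord, `e = 2`) cell at `p = 3` from the twist-unit datum ⇐ `PrintedFacts` ∧ Hsieh A ∧ LZZ ∧ CGLS Prop. 14 ∧ Castella–Hsieh signed ∧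
  [DIV.dvd] (preprint) ∧ Bleher et al. 3.3.1 ∧ de Shalit II.6.4 ∧ Hida Thm I (NAT branch = generation 25 verbatim; anomalous branch = §1 at the Ribet-normalised partner).
INPUTS DISPLAYED, upper half per pair at `p = 3` after this file: nothing from arXiv:2402.12781.
HONEST FRAMING: compositions of tree theorems, CONDITIONAL BY NAME on the displayed statements; no definition, no named fact, no `sorry`; closes no item; BSD proved
for no curve; «closes rung: none».  References: [KellerYin2024b] Thm. 3.3.6 ∘ Prop. 3.4.4; [CastellaGrossiLeeSkinner2022] Prop. 14; [BleherEtAl2020] Thm. 3.3.1;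
[deShalit1987] II.6.4; [Hida2010MuInvariant] Thm. I; [CastellaHsieh2018] §3.3; [Hsieh2014] Thm. A; [LiuZhangZhang2018]; [JetchevSkinnerWan2017] §7.4.1;
[Miller2011LMS] Def. 1.1; [Ribet1976] Prop. 2.1; [SilvermanAEC2009] X.5.4, III.4.11; this seat gen 25/28/32 (`…UpperGordCellThreeAnomalousOfPartnerClass`), F47a/F47f.
-/

set_option autoImplicit false
set_option linter.dupNamespace false -- the summit namespace `…BirchSwinnertonDyer.BirchSwinnertonDyer.Theorems` (Sub = Summit, D-0017) trips it

noncomputable section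

open scoped Classical NumberField

open Field NumberField IsDedekindDomain WeierstrassCurve PowerSeries
  Literature.NumberTheory.EllipticCurves Literature.NumberTheory.EllipticCurves.GreenbergSelmer
  Literature.NumberTheory.GaloisRepresentations Literature.NumberTheory.GaloisCohomology
  Literature.NumberTheory.EllipticCurves.ModularForms Literature.NumberTheory.EllipticCurves.Rank1Residual
  Literature.NumberTheory.EllipticCurves.Rank1Residual.Typed
  Literature.NumberTheory.EllipticCurves.IwasawaAlgebra
  Literature.NumberTheory.EllipticCurves.KellerYin2024 Literature.NumberTheory.EllipticCurves.CaiShuTian2014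
  Summit.BirchSwinnertonDyer.Rank1Residual Summit.BirchSwinnertonDyer.Rank1Residual.Additive
  Summit.BirchSwinnertonDyer.Rank1Residual.X11b
  Summit.BirchSwinnertonDyer.Rank1Residual.X11b.AcSelmer Summit.BirchSwinnertonDyer.Rank1Residual.X11b.Halves
  Summit.BirchSwinnertonDyer.Rank1Residual.X11b.CongruenceLimit
  Summit.BirchSwinnertonDyer.BirchSwinnertonDyer.Theorems
  Summit.BirchSwinnertonDyer.BirchSwinnertonDyer.Theorems.SchneiderFree
  Summit.BirchSwinnertonDyer.BirchSwinnertonDyer.Theorems.SchneiderFree.Upper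
  Summit.BirchSwinnertonDyer.BirchSwinnertonDyer.Theorems.SchneiderFree.KYRead
  Summit.BirchSwinnertonDyer.BirchSwinnertonDyer.Theorems.SchneiderFreeAdditiveX3
  Summit.BirchSwinnertonDyer.BirchSwinnertonDyer.Theorems.SchneiderFreeAdditiveX3.LZZMatch
  Summit.BirchSwinnertonDyer.BirchSwinnertonDyer.Theorems.SchneiderFreeAdditiveX3.ControlDischarged
  Summit.BirchSwinnertonDyer.BirchSwinnertonDyer.Theorems.SchneiderFreeAdditiveX3.KYBranchOnly
  Summit.BirchSwinnertonDyer.BirchSwinnertonDyer.Theorems.SchneiderFreeAdditiveX3.KYBranchHalves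
  Summit.BirchSwinnertonDyer.BirchSwinnertonDyer.Theorems.SchneiderFreeAdditiveX3.KYMuZeroOfPrint
  Summit.BirchSwinnertonDyer.BirchSwinnertonDyer.Theorems.SchneiderFreeAdditiveX3.UpperOfPrint
  Summit.BirchSwinnertonDyer.BirchSwinnertonDyer.Theorems.SchneiderFreeAdditiveX3.UpperOfPrintDvd
  Summit.BirchSwinnertonDyer.BirchSwinnertonDyer.Theorems.SchneiderFreeAdditiveX3.UpperOfPrintNonAnomalousTwist
  Summit.BirchSwinnertonDyer.BirchSwinnertonDyer.Theorems.SchneiderFreeAdditiveX3.TwistThreeResidualPair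
  Summit.BirchSwinnertonDyer.BirchSwinnertonDyer.Theorems.SchneiderFreeAdditiveX3.AnomalousTwistMuZero
  Summit.BirchSwinnertonDyer.BirchSwinnertonDyer.Theorems.SchneiderFreeAdditiveX3.UpperThreeAnomalousOfPartner
  Summit.BirchSwinnertonDyer.BirchSwinnertonDyer.Theorems.SchneiderFreeAdditiveX3.ResidualPairIsogeny
  Summit.BirchSwinnertonDyer.BirchSwinnertonDyer.Theorems.EisensteinPrimesMuLambda

open Literature.NumberTheory.EllipticCurves.BCGKPST2020 Literature.NumberTheory.EllipticCurves.DeShalit1987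
  Literature.NumberTheory.EllipticCurves.Hida2010MuInvariant
open Literature.NumberTheory.EllipticCurves.CastellaGrossiLeeSkinner2022 (prop14_residualCharacterSelmer_finite)

open Summit.BirchSwinnertonDyer.BirchSwinnertonDyer.Theses.SchneiderFreeAdditiveX3Upper

open Summit.BirchSwinnertonDyer.BirchSwinnertonDyer.Theorems.SchneiderFreeAdditiveX3.UpperThreeAnomalousOfPartnerClass

namespace Summit.BirchSwinnertonDyer.BirchSwinnertonDyer.Theorems.SchneiderFreeAdditiveX3.UpperThreeAnomalousOfPartnerClassTree

/-! ### §1 The wing's field co-socket for an anomalous twist with a normalised member of the partner class — no [RH], no [PWL-θ] -/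

/-- **WING field co-socket `AdditiveIMCUpperBDPInputManinAtField W 3 K` (`d_K ≠ −3`) for an ANOMALOUS twist ⇐ Kolyvagin ∧ modularity ∧ Hsieh 2014 Thm. A ∧ LZZ 2018 ∧
Castella–Hsieh signed ∧ [DIV.dvd] (PREPRINT) ∧ Bleher et al. 2020 Thm. 3.3.1 ∧ de Shalit II.6.4 ∧ Hida Thm I ∧ ONE statement about the class: `W^(−3) ~ V` with `V` globally
minimal, good ordinary and anomalous at `3`, all rational `3`-lines of `V` ramified at `3`.**  Generation 32's `…_of_RH_of_PWL_of_partnerClass` with its [RH]/[PWL-θ] binders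
replaced by the three published facts that feed FILE 6's tree `μ`-provider; proof token-identical otherwise.  CONDITIONAL BY NAME; nothing asserted about BSD; the crux
and the wing stay OPEN. [cite: KellerYin2024b, Thm. 3.3.6 and Prop. 3.4.4 (arXiv:2410.23241 p. 19) (preprint; hypothesis)] [cite: BleherEtAl2020, §3.3 Thm. 3.3.1]
[cite: deShalit1987, II.6.4] [cite: Hida2010MuInvariant, Thm. I] [cite: CastellaHsieh2018, §3.3, Def. 3.7 and Prop. 3.8] [cite: Hsieh2014, Thm. A p. 712]
[cite: LiuZhangZhang2018, Thm 1.5.1 and Thm 1.5.3] [cite: SilvermanAEC2009, X.5 Cor. 5.4, Cor. III.4.11] -/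
theorem additiveIMCUpperBDPInputManinAtField_three_of_tree_of_partnerClass
    (hKo : ∀ (N : ℕ) [NeZero N] (W : WeierstrassCurve ℚ) (K : Type) [Field K] [NumberField K],
      Literature.NumberTheory.EllipticCurves.kolyvagin N W K)
    (hPar : nonempty_modularParametrizationData)
    (hA : Hsieh2014.thmA_exists_isHsiehLFunction_unrPeriod_anyLevel)
    (hL : LiuZhangZhang2018.thm151_thm153_modularCurve_heegnerVector_additive)
    (hdvd : thm336_dvd_branch_OPEN) (hCHσ : castellaHsieh2018_exists_isBranchBDPLFunction_signed)
    (h331 : thm331_rubin_exists_katzMeasure₂_pseudoIso_span_eq)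
    (hFE : thmII64_katzMeasure₂_functionalEquation) (hO1 : thmI_mu_katzBranch_reflect_eq_zero)
    {W : WeierstrassCurve ℚ} [W.IsElliptic] [W.IsGloballyMinimal] (hX : ClassX3 W 3) (hSG : Additive.SubGordTwo W 3)
    (hlat : ∃ Φ : AddSubgroup (geomTorsion W ((3 : ℕ) : ℤ)), IsRationalLine W 3 Φ ∧ ¬ LineDecompositionTrivialAt W 3 Φ)
    {V : WeierstrassCurve ℚ} [V.IsElliptic] [V.IsGloballyMinimal] (hV : (W.quadraticTwist (-3 : ℚ)).IsIsogenous V)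
    (hord : GoodOrd V 3) (hanom : (3 : ℤ) ∣ V.frobeniusTrace 3 - 1)
    (hlatV : ∀ Φ : AddSubgroup (geomTorsion V ((3 : ℕ) : ℤ)), IsRationalLine V 3 Φ → ¬ LineUnramifiedAt V 3 Φ)
    (K : Type) [Field K] [NumberField K] (hdK : NumberField.discr K ≠ -3) :
    AdditiveIMCUpperBDPInputManinAtField W 3 K := by
  have hd0 : (-3 : ℚ) ≠ 0 := by norm_num
  haveI := W.isElliptic_quadraticTwist hd0
  -- the presentation `W = D⁻¹ • (W^(−3))^(−3)`
  obtain ⟨D, hD⟩ := exists_quadraticTwist_quadraticTwist_eq_smul W hd0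
  have hC₁ : D⁻¹ • (W.quadraticTwist (-3 : ℚ)).quadraticTwist (-3 : ℚ) = W := by rw [hD, inv_smul_smul]
  -- `W`'s Keller–Yin line and its Teichmüller pair
  obtain ⟨Ψ, hΨ, hΨnt⟩ := hlat
  obtain ⟨θa, θb, hsW, hqW⟩ := EisensteinCharacterInvariantsAtThreeCharacterCutEq.exists_teichmullerPair_of_line W 3 hΨ
  -- `V[3]` is reducible: `Ψ` untwists onto `W^(−3) ~ V`
  have h1 : (1 : VariableChange ℚ) • W.quadraticTwist (-3 : ℚ) = W.quadraticTwist (-3 : ℚ) := one_smul _ _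
  obtain ⟨Ψ₁, hΨ₁, -, -⟩ := exists_isRationalLine_teichmullerPair_swap_of_negThree_twist (1 : VariableChange ℚ) h1 hΨ hsW hqW
  have hredV : Red V 3 :=
    not_hasIrreducibleModPGaloisRep_of_isIsogenous hV (not_hasIrreducibleModPGaloisRep_of_isRationalLine hΨ₁)
  -- `V`'s Teichmüller pair, and `hab` as a theorem
  obtain ⟨Φ, hΦ, θsub, θquot, hsub, hquot⟩ := exists_teichmullerPair V 3 hredV
  have hab : (θa = θsub ∧ θb = θquot) ∨ (θa = θquot ∧ θb = θsub) :=
    ResidualPairIsogeny.teichmullerPair_eq_or_swap_of_negThree_twist_of_isIsogenous D⁻¹ hC₁ hV hΦ hsub hquot hΨ hsW hqW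
  exact UpperThreeAnomalousOfTree.additiveIMCUpperBDPInputManinAtField_three_of_tree_at_partner_of_isIsogenous hKo hPar hA hL hdvd hCHσ h331 hFE
    hO1 hX hSG ⟨Ψ, hΨ, hΨnt⟩ D⁻¹ hC₁ hV hord hanom hlatV hΦ hsub hquot hΨ hab hsW hqW K hdK


/-! ### §2 Per pair: the UPPER half on (G-ord, `e = 2`) at `p = 3` — no [RH], no [PWL-θ] -/

/-- **UPPER half per ANOMALOUS pair on the (G-ord, `e = 2`) cell at `p = 3` ⇐ `PrintedFacts` ∧ Hsieh 2014 Thm. A ∧ Liu–Zhang–Zhang 2018 ∧ Castella–Hsieh signed ∧ [DIV.dvd]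
(PREPRINT) ∧ Bleher et al. 3.3.1 ∧ de Shalit II.6.4 ∧ Hida Thm I ∧ the pair's twist-unit datum ∧ a Keller–Yin-normalised anomalous member of the PARTNER CLASS** — generation
32's theorem re-keyed onto §1.  CONDITIONAL; closes no item; BSD not advanced.
[cite: KellerYin2024b, Thm. 3.3.6 and Prop. 3.4.4, divisibility clause (arXiv:2410.23241 p. 19) (preprint; hypothesis)] [cite: BleherEtAl2020, §3.3 Thm. 3.3.1]
[cite: JetchevSkinnerWan2017, §7.4.1 (arXiv:1512.06894 p. 30)] [cite: CastellaHsieh2018, §3.3, Def. 3.7 and Prop. 3.8] [cite: Miller2011LMS, Def. 1.1] -/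
theorem missingUpperBoundAt_gordTwo_three_of_printedFacts_of_twistUnitAt_of_partnerClass_of_tree
    (hF : PrintedFacts) (hA : Hsieh2014.thmA_exists_isHsiehLFunction_unrPeriod_anyLevel)
    (hL : LiuZhangZhang2018.thm151_thm153_modularCurve_heegnerVector_additive)
    (hdvd : thm336_dvd_branch_OPEN) (hCHσ : castellaHsieh2018_exists_isBranchBDPLFunction_signed)
    (h331 : thm331_rubin_exists_katzMeasure₂_pseudoIso_span_eq)
    (hFE : thmII64_katzMeasure₂_functionalEquation) (hO1 : thmI_mu_katzBranch_reflect_eq_zero) :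
    ∀ (W : WeierstrassCurve ℚ) [W.IsElliptic] [W.IsGloballyMinimal],
      W.analyticRank = 1 → ClassX3 W 3 → Additive.SubGordTwo W 3 →
      (∃ (V : WeierstrassCurve ℚ) (_ : V.IsElliptic) (_ : V.IsGloballyMinimal),
        (W.quadraticTwist (-3 : ℚ)).IsIsogenous V ∧ GoodOrd V 3 ∧ (3 : ℤ) ∣ V.frobeniusTrace 3 - 1 ∧
          ∀ Φ : AddSubgroup (geomTorsion V ((3 : ℕ) : ℤ)), IsRationalLine V 3 Φ → ¬ LineUnramifiedAt V 3 Φ) →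
      Upper.TwistUnitFieldOffSliverAt W 3 → MissingUpperBoundAt W 3 := by
  obtain ⟨hGZ, hKo, hGZK, hmod, hPar, hCas, hGZ73, -, -, hHP, -, -, -⟩ := hF
  have hCtl := anticycControlAdditiveKF_proof controlFacts_proof.1 controlFacts_proof.2.1 controlFacts_proof.2.2.1
    controlFacts_proof.2.2.2 hKo
  intro W _ _ hr hX hG hcls hTU
  obtain ⟨V, _, _, hV, hord, hanom, hlatV⟩ := hcls
  have hp2 : (3 : ℕ) ≠ 2 := by norm_num
  have hd0 : (-3 : ℚ) ≠ 0 := by norm_num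
  have hpN : 3 ∣ W.conductorNorm ℤ := (W.dvd_conductorNorm_iff_not_hasGoodReductionAtPrime 3).mpr hX.2.1
  refine Upper.missingUpperBoundAt_of_goodMemberCoStepLField_of_twistUnitFieldOffSliver hGZ hKo hGZK hmod hGZ73 hCas hHP W 3 hr hp2 hpN
    (fun K _ _ hK _ hpd hdK ↦ coChainMemberField_gordTwo_of_coIMCFieldAt_isogenous_of_control hKo hPar hCtl W 3 hr hp2 hX hG K hK hpd
      fun W₁ _ _ hiso₁ hX₁ hS₁ hlat₁ ↦ ?_) hTU
  -- the class statement passes to the good member: `W₁^(−3) ~ W^(−3) ~ V`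
  have hV₁ : (W₁.quadraticTwist (-3 : ℚ)).IsIsogenous V := (hiso₁.symm_of_charZero.quadraticTwist hd0).trans' hV
  exact additiveIMCUpperBDPInputManinAtField_three_of_tree_of_partnerClass hKo hPar hA hL hdvd hCHσ h331 hFE hO1 hX₁ hS₁ hlat₁ hV₁ hord hanom
    hlatV K hdK


/-- **UPPER half per pair on the WHOLE (G-ord, `e = 2`) cell at `p = 3` from the twist-unit datum ALONE** ⇐ `PrintedFacts` ∧ Hsieh 2014 Thm. A ∧ Liu–Zhang–Zhang 2018 ∧ CGLS
2022 Prop. 14 ∧ Castella–Hsieh signed (PUBLISHED) ∧ [DIV.dvd] (Keller–Yin 2410.23241, PREPRINT) ∧ Bleher et al. 2020 Thm. 3.3.1 ∧ de Shalit II.6.4 ∧ Hida Thm I (PUBLISHED) —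
NO statement of arXiv:2402.12781.  NAT branch: generation 25 verbatim (CGLS Prop. 14 for `μ`); anomalous branch: §2 at the Ribet-normalised partner.  CONDITIONAL BY NAME;
the LOWER half is not here; closes no item; BSD not advanced. [cite: CastellaGrossiLeeSkinner2022, §1.2 Prop. 14] [cite: KellerYin2024b, Thm. 3.3.6 and Prop. 3.4.4 (preprint; hypothesis)]
[cite: BleherEtAl2020, §3.3 Thm. 3.3.1] [cite: deShalit1987, II.6.4] [cite: Hida2010MuInvariant, Thm. I] [cite: Ribet1976, Prop. 2.1] [cite: Miller2011LMS, Def. 1.1] -/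
theorem missingUpperBoundAt_gordTwo_three_of_printedFacts_of_twistUnitAt_of_tree
    (hF : PrintedFacts) (hA : Hsieh2014.thmA_exists_isHsiehLFunction_unrPeriod_anyLevel)
    (hL : LiuZhangZhang2018.thm151_thm153_modularCurve_heegnerVector_additive)
    (hdvd : thm336_dvd_branch_OPEN) (h14 : prop14_residualCharacterSelmer_finite)
    (hCHσ : castellaHsieh2018_exists_isBranchBDPLFunction_signed)
    (h331 : thm331_rubin_exists_katzMeasure₂_pseudoIso_span_eq)
    (hFE : thmII64_katzMeasure₂_functionalEquation) (hO1 : thmI_mu_katzBranch_reflect_eq_zero) :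
    ∀ (W : WeierstrassCurve ℚ) [W.IsElliptic] [W.IsGloballyMinimal],
      W.analyticRank = 1 → ClassX3 W 3 → Additive.SubGordTwo W 3 →
      Upper.TwistUnitFieldOffSliverAt W 3 → MissingUpperBoundAt W 3 := by
  intro W _ _ hr hX hG hTU
  rcases forall_twist_not_anomalous_or_exists_anomalous_twist W hX hG with hNAT | ⟨V₀, _, _, C₀, hord₀, hC₀, hanom₀⟩
  · exact missingUpperBoundAt_gordTwo_odd_of_printedFacts_of_twistUnitAt_of_forall_twist_of_hsieh_of_lzz_of_KY_dvd_of_prop14_of_castellaHsieh_signed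
      hF hA hL hdvd h14 hCHσ W 3 (by norm_num) hr hX hG hNAT hTU
  · exact missingUpperBoundAt_gordTwo_three_of_printedFacts_of_twistUnitAt_of_partnerClass_of_tree
      hF hA hL hdvd hCHσ h331 hFE hO1 W hr hX hG (exists_partnerClass_of_anomalous_twist_model hX.1 C₀ hC₀ hord₀ hanom₀) hTU


end Summit.BirchSwinnertonDyer.BirchSwinnertonDyer.Theorems.SchneiderFreeAdditiveX3.UpperThreeAnomalousOfPartnerClassTree

end
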